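/-
Copyright (c) 2026. All rights reserved.
Released under Apache 2.0 license as described in the file LICENSE.
Authors: abc-iut cell, wave-W6 seat abc-iut-w6-d074 (row THM26II-SIGMA-STAR, abc-iut-L4-lead RULING #7j).
-/
import Literature.AnabelianGeometry.AbsoluteAnabelian.CoinvariantRankGeneralLowerBoundProofs
import Literature.AnabelianGeometry.AbsoluteAnabelian.CoinvariantRankProofs
import Literature.AnabelianGeometry.AbsoluteAnabelian.ProfiniteRankProofs
import HarnessLib

/-!
# `δ¹_l(P) = δ¹_l(Q) + m` for an extension split over an open subgroup — GENERAL coinvariant target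

Proof-only companion (no definitions, no named facts), part 2 of 2 (part 1:
`CoinvariantRankGeneralLowerBoundProofs.lean`).  abc-iut-L4-d3's `CoinvariantRankProofs.lean` proves
the rank identity behind S. Mochizuki, *The Absolute Anabelian Geometry of Hyperbolic Curves* (2004)
[AbsAnab], proof of Lemma 1.1.4 (ii) p. 8, for a coinvariant quotient `q : D ↠ Ẑ^m`; S. Mochizuki,
*Topics in Absolute Anabelian Geometry I* (2012) [AbsTopI], proof of Thm 2.6 (ii) p. 23 l. 15–20,
uses the same argument with a free `Ẑ_Σ`-module `Q` ("`Q_l := Q ⊗ ℤ_l`", `Σ` the construction-data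
prime set).  HERE the target of `q` is an ARBITRARY topological group `T`; what the upper bound needs
at the prime `l` is a finite family `t₁, …, t_n ∈ T` DETERMINING the continuous additive `ℚ_l`-valued
functions on `T` (such a function vanishing at every `t_k` vanishes identically) — for `Ẑ^m` this is
the density of `ℤ^m` (`eq_zero_of_additive_of_apply_eta_single`), for `Ẑ_Σ^m` and `l ∈ Σ` the
coordinate vectors serve, and for `Ẑ_Σ^m` and `l ∉ Σ` the EMPTY family serves (no continuous
characters to `ℤ_l` at all).  The proofs are abc-iut-L4-d3's, verbatim up to this abstraction (two of
its generic `private` lemmas are re-proved here because they are not exported):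

* `freeProlRank_le_add_of_coinvariants_of_target` — `δ¹_l(P) ≤ δ¹_l(Q) + n`;
* `freeProlRank_eq_add_of_split_of_target` — with the lower bound of part 1 (elements `t_k ∈ q(D)`
  and `L : T → ℤ_l^m`, `L(t_k) = e_k`): `δ¹_l(P) = δ¹_l(Q) + m`;
* `freeProlRank_eq_of_coinvariants_of_target_trivial` — if `T` has NO non-zero continuous additive
  function to `ℚ_l` (e.g. `T` pro-`Σ`, `l ∉ Σ`): `δ¹_l(P) = δ¹_l(Q)`, with no splitting needed.

Setting: `π : P ↠ Q` a continuous surjection of compact groups (`Q` Hausdorff) with kernel `D`;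
`q : D ↠ T` a continuous surjection onto a Hausdorff group whose kernel is killed by every
`P`-invariant continuous character `D → ℤ_l`.

HONEST FRAMING: classical profinite group theory; nothing here bears on [IUTchIII] Cor. 3.12.
-/

noncomputable section

open Topology Module

universe u v w

namespace Literature.AnabelianGeometry.AbsoluteAnabelian

section Rank

variable {P : Type u} [Group P] [TopologicalSpace P] [CompactSpace P]
variable {Q : Type v} [Group Q] [TopologicalSpace Q]
variable {T : Type w} [Group T] [TopologicalSpace T]

/-- Linear algebra of the restriction map (rank–nullity): if `N` independent functions
`u_i : X → K` have the property that a `K`-combination vanishing at the `m` points `ι(y_k)`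
vanishes on all of `ι(Y)`, then at least `N - m` independent combinations of the `u_i` vanish on
`ι(Y)`.  (abc-iut-L4-d3's private `exists_kernel_family`, re-proved.)
[cite: MochizukiAbsAnab2004, Lemma 1.1.4 (ii) proof p.8] -/
private theorem exists_kernel_family' {K : Type*} [Field K] {X Y : Type*} (ι : Y → X) {N m : ℕ}
    (u : Fin N → (X → K)) (hu : LinearIndependent K u) (y : Fin m → Y)
    (HA : ∀ c : Fin N → K, (∀ k, ∑ i, c i * u i (ι (y k)) = 0) →
      ∀ d, ∑ i, c i * u i (ι d) = 0) :
    ∃ (k : ℕ) (w : Fin k → (X → K)) (c : Fin k → Fin N → K),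
      N ≤ k + m ∧ LinearIndependent K w ∧ (∀ t, ∑ i, c t i • u i = w t) ∧
        ∀ t d, w t (ι d) = 0 := by
  classical
  -- the restriction map in coordinates: `F c = (Σ c_i u_i)|_Y`
  obtain ⟨F, hF⟩ : ∃ F : (Fin N → K) →ₗ[K] (Y → K),
      ∀ (c : Fin N → K) (d : Y), F c d = ∑ i, c i * u i (ι d) :=
    ⟨(LinearMap.funLeft K K ι).comp (Fintype.linearCombination K u), fun c d => by
      simp [Fintype.linearCombination_apply, Finset.sum_apply, smul_eq_mul]⟩
  have hrn := LinearMap.finrank_range_add_finrank_ker F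
  rw [Module.finrank_fin_fun] at hrn
  -- (1) `finrank (range F) ≤ m`: evaluation at the `y_k` is injective on `range F`
  obtain ⟨ev, hev⟩ : ∃ ev : (Y → K) →ₗ[K] (Fin m → K), ∀ g k, ev g k = g (y k) :=
    ⟨LinearMap.funLeft K K y, fun g k => rfl⟩
  have hev0 : ∀ g ∈ LinearMap.range F, ev g = 0 → g = 0 := by
    rintro g ⟨c, rfl⟩ hz
    have hzero : ∀ k, ∑ i, c i * u i (ι (y k)) = 0 := by
      intro k
      rw [← hF, ← hev (F c) k, hz]
      rfl
    funext d
    rw [hF]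
    exact HA c hzero d
  have hrange : Module.finrank K (LinearMap.range F) ≤ m := by
    have hinj : Function.Injective (ev.domRestrict (LinearMap.range F)) := by
      intro x z hxz
      apply Subtype.ext
      have hxz' : ev ((x : Y → K) - z) = 0 := by
        rw [map_sub]
        exact sub_eq_zero.mpr hxz
      have h := hev0 ((x : Y → K) - z) (Submodule.sub_mem _ x.2 z.2) hxz'
      exact sub_eq_zero.mp h
    have := LinearMap.finrank_le_finrank_of_injective hinj
    simpa [Module.finrank_fin_fun] using this
  -- (2) a basis of `ker F`, pushed into `X → K` along the injective `c ↦ Σ c_i u_i`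
  obtain ⟨k, hk⟩ : ∃ k, Module.finrank K (LinearMap.ker F) = k := ⟨_, rfl⟩
  have hNk : N ≤ k + m := by omega
  let b := Module.finBasis K (LinearMap.ker F)
  refine ⟨k, fun t => ∑ i, (b (Fin.cast hk.symm t) : Fin N → K) i • u i,
    fun t => (b (Fin.cast hk.symm t) : Fin N → K), hNk, ?_, fun t => rfl, ?_⟩
  · -- independence
    have hinj : LinearMap.ker (Fintype.linearCombination K u) = ⊥ :=
      LinearMap.ker_eq_bot.mpr ((linearIndependent_iff_injective_fintypeLinearCombination).mp hu)
    have h1 := b.linearIndependent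
    have h2 : LinearIndependent K (fun t => ((b t : LinearMap.ker F) : Fin N → K)) :=
      h1.map' (LinearMap.ker F).subtype (Submodule.ker_subtype _)
    have h3 := h2.map' (Fintype.linearCombination K u) hinj
    have h4 := h3.comp (Fin.cast hk.symm) (Fin.cast_injective _)
    have heq : (fun t => ∑ i, (b (Fin.cast hk.symm t) : Fin N → K) i • u i) =
        ((⇑(Fintype.linearCombination K u) ∘ fun t => ((b t : LinearMap.ker F) : Fin N → K)) ∘
          Fin.cast hk.symm) := by
      funext t
      simp [Fintype.linearCombination_apply]
    rw [heq]
    exact h4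
  · -- vanishing on `Y`
    intro t d
    have hmem : F (b (Fin.cast hk.symm t) : Fin N → K) = 0 := (b (Fin.cast hk.symm t)).2
    have h2 := congrFun hmem d
    rw [hF] at h2
    simpa [Finset.sum_apply, smul_eq_mul] using h2

/-- Step (1) of `δ¹_l(P) ≤ δ¹_l(Q) + n`, general target: a `ℚ_l`-combination of characters of `P`,
restricted to `D`, factors through `q : D ↠ T`, so it vanishes on `D` as soon as it vanishes at
preimages of a family `t₁, …, t_n` determining the continuous additive `ℚ_l`-valued functions on
`T`. [cite: MochizukiAbsAnab2004, Lemma 1.1.4 (ii) proof p.8] -/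
private theorem combination_eq_zero_on_of_apply_eq_zero' [T2Space T]
    (D : Subgroup P) [hDn : D.Normal] (hDc : IsClosed (D : Set P))
    (q : D →ₜ* T) (hq : Function.Surjective q) (l : ℕ) [Fact l.Prime]
    (hqker : ∀ ψ : D →ₜ* Multiplicative ℤ_[l],
      (∀ (g : P) (d : D), ψ ⟨g * d * g⁻¹, hDn.conj_mem _ d.2 g⟩ = ψ d) →
        ∀ d, q d = 1 → ψ d = 1)
    {n : ℕ} (dk : Fin n → D)
    (hdet : ∀ g : T → ℚ_[l], Continuous g → (∀ x y, g (x * y) = g x + g y) →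
      (∀ k, g (q (dk k)) = 0) → ∀ x, g x = 0)
    {N : ℕ} (Φ : Fin N → (P →ₜ* Multiplicative ℤ_[l])) (c : Fin N → ℚ_[l])
    (hzero : ∀ k, ∑ i, c i * ((Multiplicative.toAdd (Φ i (dk k : P)) : ℤ_[l]) : ℚ_[l]) = 0)
    (d : D) :
    ∑ i, c i * ((Multiplicative.toAdd (Φ i (d : P)) : ℤ_[l]) : ℚ_[l]) = 0 := by
  classical
  haveI : CompactSpace D := isCompact_iff_compactSpace.mp hDc.isCompact
  -- each `Φ_i|_D` is `P`-invariant, hence factors through `q`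
  have hfac : ∀ i, ∃ χ : T →ₜ* Multiplicative ℤ_[l], ∀ d : D, χ (q d) = Φ i d := by
    intro i
    let ψ : D →ₜ* Multiplicative ℤ_[l] := (Φ i).comp ⟨D.subtype, continuous_subtype_val⟩
    have hψ : ∀ d : D, ψ d = Φ i d := fun d => rfl
    have hψP : ∀ (g : P) (d : D), ψ ⟨g * d * g⁻¹, hDn.conj_mem _ d.2 g⟩ = ψ d := by
      intro g d
      rw [hψ, hψ]
      change Φ i (g * d * g⁻¹) = Φ i d
      rw [map_mul, map_mul, map_inv, mul_inv_cancel_comm]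
    obtain ⟨χ, hχ⟩ := exists_continuousMonoidHom_factor q hq ψ (hqker ψ hψP)
    exact ⟨χ, fun d => by rw [hχ, hψ]⟩
  choose χ hχ using hfac
  let gbar : T → ℚ_[l] := fun x => ∑ i, c i * ((Multiplicative.toAdd (χ i x) : ℤ_[l]) : ℚ_[l])
  have hgq : ∀ d : D,
      ∑ i, c i * ((Multiplicative.toAdd (Φ i (d : P)) : ℤ_[l]) : ℚ_[l]) = gbar (q d) := by
    intro d
    simp only [gbar, hχ]
  have hgc : Continuous gbar :=
    continuous_finsetSum _ fun i _ => continuous_const.mul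
      (continuous_subtype_val.comp (continuous_toAdd.comp (χ i).continuous))
  have hgadd : ∀ x y, gbar (x * y) = gbar x + gbar y := by
    intro x y
    simp only [gbar, map_mul, toAdd_mul, PadicInt.coe_add, mul_add, Finset.sum_add_distrib]
  have hgvan : ∀ k, gbar (q (dk k)) = 0 := by
    intro k
    rw [← hgq]
    exact hzero k
  rw [hgq]
  exact hdet gbar hgc hgadd hgvan (q d)

/-- Step (2) of `δ¹_l(P) ≤ δ¹_l(Q) + n`: `k` linearly independent `ℚ_l`-combinations of characters
of `P` which vanish on `D = Ker(π)` give, after clearing denominators, `k` independent characters of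
`Q`, so `k ≤ δ¹_l(Q)`.  (abc-iut-L4-d3's private `natCast_le_freeProlRank_of_vanishing`, re-proved.)
[cite: MochizukiAbsAnab2004, Lemma 1.1.4 (ii) proof p.8] -/
private theorem natCast_le_freeProlRank_of_vanishing' [CompactSpace Q] [T2Space Q]
    (π : P →ₜ* Q) (hπ : Function.Surjective π)
    (D : Subgroup P) (hD : ∀ x, x ∈ D ↔ π x = 1) (l : ℕ) [Fact l.Prime]
    {N k : ℕ} (Φ : Fin N → (P →ₜ* Multiplicative ℤ_[l]))
    (w : Fin k → (P → ℚ_[l])) (hw : LinearIndependent ℚ_[l] w)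
    (c : Fin k → Fin N → ℚ_[l])
    (hc : ∀ t, ∑ i, c t i • (fun p : P => ((Multiplicative.toAdd (Φ i p) : ℤ_[l]) : ℚ_[l])) = w t)
    (hwD : ∀ t (d : D), w t d = 0) :
    (k : ℕ∞) ≤ freeProlRank Q l := by
  classical
  -- clear denominators
  obtain ⟨bden, hbden, hint⟩ :=
    exists_integer_multiples_padic l (fun ti : Fin k × Fin N => c ti.1 ti.2)
  choose a ha using hint
  have hΘ : ∀ t, ∃ Θ : P →ₜ* Multiplicative ℤ_[l],
      ∀ p, Multiplicative.toAdd (Θ p) = ∑ i, a (t, i) * Multiplicative.toAdd (Φ i p) :=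
    fun t => exists_padicInt_combination l Φ (fun i => a (t, i))
  choose Θ hΘ using hΘ
  have hΘw : ∀ t p, ((Multiplicative.toAdd (Θ t p) : ℤ_[l]) : ℚ_[l]) = bden * w t p := by
    intro t p
    rw [hΘ, ← hc t]
    simp only [PadicInt.coe_sum, PadicInt.coe_mul, ha, Finset.sum_apply, Pi.smul_apply,
      smul_eq_mul, Finset.mul_sum, mul_assoc]
  -- `Θ_t` kills `D`, hence factors through `π`
  have hΘD : ∀ t (p : P), π p = 1 → Θ t p = 1 := by
    intro t p hp
    have hmem : p ∈ D := (hD p).mpr hp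
    have h1 : ((Multiplicative.toAdd (Θ t p) : ℤ_[l]) : ℚ_[l]) = 0 := by
      rw [hΘw, hwD t ⟨p, hmem⟩, mul_zero]
    have h2 : Multiplicative.toAdd (Θ t p) = 0 := PadicInt.coe_eq_zero.mp h1
    exact toAdd_eq_zero.mp h2
  have hθ : ∀ t, ∃ θ : Q →ₜ* Multiplicative ℤ_[l], ∀ p, θ (π p) = Θ t p :=
    fun t => exists_continuousMonoidHom_factor π hπ (Θ t) (hΘD t)
  choose θ hθ using hθ
  -- the `θ_t` are independent characters of `Q`
  have hbq : (bden : ℚ_[l]) ≠ 0 := fun h => hbden (PadicInt.coe_eq_zero.mp h)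
  have hθind : LinearIndependent ℚ_[l]
      (fun (t : Fin k) (x : Q) => ((Multiplicative.toAdd (θ t x) : ℤ_[l]) : ℚ_[l])) := by
    have hinj := LinearMap.funLeft_injective_of_surjective (R := ℚ_[l]) (M := ℚ_[l]) π hπ
    rw [← LinearMap.linearIndependent_iff (LinearMap.funLeft ℚ_[l] ℚ_[l] π)
      (LinearMap.ker_eq_bot.mpr hinj)]
    have heq : (LinearMap.funLeft ℚ_[l] ℚ_[l] π) ∘
        (fun (t : Fin k) (x : Q) => ((Multiplicative.toAdd (θ t x) : ℤ_[l]) : ℚ_[l])) =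
        fun t => (Units.mk0 (bden : ℚ_[l]) hbq) • w t := by
      funext t p
      simp only [Function.comp_apply, LinearMap.funLeft_apply, Pi.smul_apply, hθ, hΘw]
      rfl
    rw [heq]
    exact hw.units_smul fun _ => Units.mk0 (bden : ℚ_[l]) hbq
  exact le_freeProlRank_of_linearIndependent (H := Q) l θ hθind

/-- **`δ¹_l(P) ≤ δ¹_l(Q) + n`, general coinvariant target.**  `π : P ↠ Q` compact groups with kernel
`D`; `q : D ↠ T` a continuous surjection onto a Hausdorff group whose kernel is killed by the
`P`-invariant continuous characters `D → ℤ_l`; `d₁, …, d_n ∈ D` such that the `q(d_k)` DETERMINE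
the continuous additive `ℚ_l`-valued functions on `T`.  Then `δ¹_l(P) ≤ δ¹_l(Q) + n`: restricting
`N` independent characters of `P` to `D` lands in a space of dimension `≤ n`, and the kernel of the
restriction consists, after clearing denominators, of characters of `Q` (rank–nullity).  For
`T = Ẑ^m` (`n = m`, `q(d_k) = η(e_k)`) this is abc-iut-L4-d3's `freeProlRank_le_add_of_coinvariants`.
[cite: MochizukiAbsAnab2004, Lemma 1.1.4 (ii) proof p.8] -/
theorem freeProlRank_le_add_of_coinvariants_of_target [CompactSpace Q] [T2Space Q] [T2Space T]
    (π : P →ₜ* Q) (hπ : Function.Surjective π)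
    (D : Subgroup P) [hDn : D.Normal] (hD : ∀ x, x ∈ D ↔ π x = 1)
    (q : D →ₜ* T) (hq : Function.Surjective q)
    (l : ℕ) [Fact l.Prime]
    (hqker : ∀ ψ : D →ₜ* Multiplicative ℤ_[l],
      (∀ (g : P) (d : D), ψ ⟨g * d * g⁻¹, hDn.conj_mem _ d.2 g⟩ = ψ d) →
        ∀ d, q d = 1 → ψ d = 1)
    {n : ℕ} (dk : Fin n → D)
    (hdet : ∀ g : T → ℚ_[l], Continuous g → (∀ x y, g (x * y) = g x + g y) →
      (∀ k, g (q (dk k)) = 0) → ∀ x, g x = 0) :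
    freeProlRank P l ≤ freeProlRank Q l + n := by
  classical
  -- `D` is closed in `P`
  have hDc : IsClosed (D : Set P) := by
    have : (D : Set P) = π ⁻¹' {1} := by
      ext x; simpa using hD x
    rw [this]
    exact isClosed_singleton.preimage π.continuous
  refine (ENat.forall_natCast_le_iff_le).mp fun N hN => ?_
  obtain ⟨Φ, hΦ⟩ := exists_linearIndependent_of_le_freeProlRank (H := P) l hN
  -- rank–nullity for the restriction of the span of the `Φ_i` to `D`
  obtain ⟨k, w, c, hNk, hw, hc, hwD⟩ := exists_kernel_family' (K := ℚ_[l]) ((↑) : D → P)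
    (fun i p => ((Multiplicative.toAdd (Φ i p) : ℤ_[l]) : ℚ_[l])) hΦ dk
    (fun c hz d => combination_eq_zero_on_of_apply_eq_zero' D hDc q hq l hqker dk hdet Φ c hz d)
  have hkQ : (k : ℕ∞) ≤ freeProlRank Q l :=
    natCast_le_freeProlRank_of_vanishing' π hπ D hD l Φ w hw c hc hwD
  calc (N : ℕ∞) ≤ ((k + n : ℕ) : ℕ∞) := by exact_mod_cast hNk
    _ = (k : ℕ∞) + n := by norm_cast
    _ ≤ freeProlRank Q l + n := add_le_add hkQ le_rfl

/-- **`δ¹_l(P) = δ¹_l(Q)` when the coinvariant target has no `ℚ_l`-valued characters** (general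
target, EMPTY determining family): if every continuous additive `T → ℚ_l` vanishes — e.g. `T` is
pro-`Σ` and `l ∉ Σ`, the case "`δ¹_l(Π) = δ¹_l(G)` for `l ∉ Σ`" of [AbsTopI] Thm 2.6 (ii) (proof
p. 23 l. 19–20) — then `δ¹_l(P) = δ¹_l(Q)`; no splitting is needed (`≥` is the pull-back along `π`).
[cite: MochizukiAbsTopI2012, Thm 2.6 (ii) p.21] -/
theorem freeProlRank_eq_of_coinvariants_of_target_trivial [CompactSpace Q] [T2Space Q] [T2Space T]
    (π : P →ₜ* Q) (hπ : Function.Surjective π)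
    (D : Subgroup P) [hDn : D.Normal] (hD : ∀ x, x ∈ D ↔ π x = 1)
    (q : D →ₜ* T) (hq : Function.Surjective q)
    (l : ℕ) [Fact l.Prime]
    (hqker : ∀ ψ : D →ₜ* Multiplicative ℤ_[l],
      (∀ (g : P) (d : D), ψ ⟨g * d * g⁻¹, hDn.conj_mem _ d.2 g⟩ = ψ d) →
        ∀ d, q d = 1 → ψ d = 1)
    (htriv : ∀ g : T → ℚ_[l], Continuous g → (∀ x y, g (x * y) = g x + g y) → ∀ x, g x = 0) :
    freeProlRank P l = freeProlRank Q l := by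
  refine le_antisymm ?_ (freeProlRank_le_of_surjective π hπ l)
  have h := freeProlRank_le_add_of_coinvariants_of_target π hπ D hD q hq l hqker
    (n := 0) Fin.elim0 (fun g hg hadd _ => htriv g hg hadd)
  simpa using h

/-- **`δ¹_l(P) = δ¹_l(Q) + m`, general coinvariant target.**  In the setting of
`freeProlRank_le_add_of_coinvariants_of_target`, assume moreover the splitting data of
[AbsAnab] §1.1 (an open `P₁ ⊇ D` with `r : P₁ → P`, `p · r(p)⁻¹ ∈ D`, `r|_D = 1`), that `q` is
`P`-invariant, and that the determining family `q(d₁), …, q(d_m)` admits a continuous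
`L : T → ℤ_l^m` with `L(q(d_k)) = e_k`.  Then `δ¹_l(P) = δ¹_l(Q) + m` — [AbsAnab] p. 8 "it follows
formally from (∗)" / [AbsTopI] p. 23 "`δ¹_l(Π) = δ¹_l(G) + dim_{ℚ_l}(Q_l ⊗ ℚ_l)`".  For `T = Ẑ^m`
this is abc-iut-L4-d3's `freeProlRank_eq_add_of_split`.
[cite: MochizukiAbsAnab2004, Lemma 1.1.4 (ii) proof p.8] -/
theorem freeProlRank_eq_add_of_split_of_target [IsTopologicalGroup P] [CompactSpace Q] [T2Space Q]
    [T2Space T]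
    (π : P →ₜ* Q) (hπ : Function.Surjective π)
    (D : Subgroup P) [hDn : D.Normal] (hD : ∀ x, x ∈ D ↔ π x = 1)
    (P₁ : Subgroup P) (hP₁ : IsOpen (P₁ : Set P)) (hDP₁ : D ≤ P₁)
    (r : P₁ →ₜ* P) (hr : ∀ p : P₁, (p : P) * (r p)⁻¹ ∈ D)
    (hrD : ∀ p : P₁, (p : P) ∈ D → r p = 1)
    (q : D →ₜ* T) (hq : Function.Surjective q)
    (hqP : ∀ (g : P) (d : D), q ⟨g * d * g⁻¹, hDn.conj_mem _ d.2 g⟩ = q d)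
    (l : ℕ) [Fact l.Prime]
    (hqker : ∀ ψ : D →ₜ* Multiplicative ℤ_[l],
      (∀ (g : P) (d : D), ψ ⟨g * d * g⁻¹, hDn.conj_mem _ d.2 g⟩ = ψ d) →
        ∀ d, q d = 1 → ψ d = 1)
    {m : ℕ} (dk : Fin m → D)
    (hdet : ∀ g : T → ℚ_[l], Continuous g → (∀ x y, g (x * y) = g x + g y) →
      (∀ k, g (q (dk k)) = 0) → ∀ x, g x = 0)
    (L : T →ₜ* Multiplicative (Fin m → ℤ_[l]))
    (hL : ∀ j k, Multiplicative.toAdd (L (q (dk k))) j = if j = k then (1 : ℤ_[l]) else 0) :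
    freeProlRank P l = freeProlRank Q l + m :=
  le_antisymm (freeProlRank_le_add_of_coinvariants_of_target π hπ D hD q hq l hqker dk hdet)
    (freeProlRank_add_le_of_split_of_target π hπ D hD P₁ hP₁ hDP₁ r hr hrD q hqP l
      (fun k => q (dk k)) (fun k => ⟨dk k, rfl⟩) L hL)

end Rank

end Literature.AnabelianGeometry.AbsoluteAnabelian

end
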